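import Mathlib
import Literature.NumberTheory.LFunctions.Zhang2022.Section17U007Engine
import Literature.NumberTheory.LFunctions.Zhang2022.Section17Step17u006N
import Literature.NumberTheory.LFunctions.Zhang2022.TypedSection17
import Literature.NumberTheory.LFunctions.Zhang2022.Section17NuOneStarMajorant
import HarnessLib

/-!
# Zhang (2022) §17.u007 at the manuscript's data: `ν*(n) − 𝔢₀ᴰν(n)` below `D⁴` is majorised by a
# `τ`-polynomial with coefficients `η ≍ 𝓛⁻⁸`

Topic `Literature/NumberTheory/LFunctions/Zhang2022` (Landau–Siegel audit tree; verdict-neutral).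
Y. Zhang, *Discrete mean estimates and the Landau–Siegel zero*, arXiv:2211.02515v1 (2022)
[Zhang2022LandauSiegel] — **an unrefereed manuscript under adjudication**; nothing here asserts or
denies its Theorems 1–2. DAG node `Z22:§17.u007` [Z22 p.96, tex L4735–L4747] ("A detailed analysis
shows that (17.2) remains valid if … `κ₂(n₁)` is replaced by `(1∗μ)(n₁)`, …
`χ(n₂n₃)(ϰ₁(n₂)+ι₂ϰ₂(n₂))(ῑ₃ϰ₃(n₃)+ῑ₄ϰ₄(n₃))` is replaced by `𝔢₀χ(n₂n₃)` …, `g̃₂(n₅)`, `g̃₃(n₆)` by `1`").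

This file instantiates the engine `Section17U007Engine` at the manuscript's coefficient sequence
`ν*` (`Typed.Section17.nuStar`, in the `N`-coefficient reading `Typed.Section17.step17_u006N_holds`):
below `D⁴`, `ν* = E₁E₂E₃μ²·χA₁·χA₂·χμ` in the ring of arithmetic functions with `E₁ = n^{−β₁}`
(`MeanSquareMajorant.powI`), `E_{2,3} = n^{−β_{2,3}}g*(T²/n)` (`Typed.Section17.nN`),
`A₁ = ϰ₁+ι₂ϰ₂`, `A₂ = ῑ₃ϰ₃+ῑ₄ϰ₄`, and the main term is `𝔢₀ᴰ·ν` with the `D`-dependent (17.4)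
`𝔢₀ᴰ = A₁(1)A₂(1)` (`Typed.Section17.frake0D`). PROVED (theorems only; no definitions, no named facts):

* `nuStar_eq_ringProduct` — the identification below `D⁴`;
* `norm_nuStar_sub_frake0D_nu_le_of_bounds` — given `η ≥ 0` with `|E_i(m) − 1| ≤ η`,
  `|A₁(m) − A₁(1)| ≤ (1+|ι₂|)η`, `|A₂(m) − A₂(1)| ≤ (|ι₃|+|ι₄|)η` on `1 ≤ m < D⁴`, the engine's bound
  `|ν*(n) − 𝔢₀ᴰν(n)| ≤ B_η(n)` for `1 ≤ n < D⁴`, `B_η` an explicit `τ`-polynomial (`norm_error_le`).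

The pointwise bounds themselves (`η = K(c′)𝓛⁻⁸` for large `D`) and the summation against `ν(n)/n`
are the companion `Section17Step17u007`. ZHANG-L discharge lane (WP16, seat zl-w16-p6), toward the
leaf `Typed.Section17.Eq17_6Rel`. WHAT THIS IS NOT: a claim about Theorems 1–2 of the source or about
Landau–Siegel zeros.

## References

* Y. Zhang, arXiv:2211.02515v1 (2022), §17 u004–u008 p.96 (tex L4728–L4750), (17.4), (8.6), (2.13).
  [cite: Zhang2022LandauSiegel, §17 u007 p.96]
-/

noncomputable section

open Finset ArithmeticFunction Complex
open scoped LSeries.notation ComplexConjugate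
open Literature.NumberTheory.LFunctions.Zhang2022.MeanSquareMajorant
open Literature.NumberTheory.LFunctions.Zhang2022.Skeleton
open Literature.NumberTheory.LFunctions.Zhang2022.Typed.Section17

namespace Literature.NumberTheory.LFunctions.Zhang2022.U007

variable (c' : ℝ) {D : ℕ} [NeZero D] (χ : DirichletCharacter ℂ D)

/-! ## Sequences as arithmetic functions -/

omit [NeZero D] in
/-- `toArithmeticFunction` at a positive integer. [folklore] -/
private theorem toAF_apply {f : ℕ → ℂ} {n : ℕ} (hn : n ≠ 0) : toArithmeticFunction f n = f n := by
  simp [toArithmeticFunction, hn]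

omit [NeZero D] in
/-- Subtraction of arithmetic functions is pointwise. [folklore] -/
private theorem af_sub_apply (F G : ArithmeticFunction ℂ) (m : ℕ) : (F - G) m = F m - G m := rfl

omit [NeZero D] in
/-- The complex Möbius sequence is the arithmetic function `μ`. [folklore] -/
private theorem toAF_moebius :
    toArithmeticFunction (fun n : ℕ => ((ArithmeticFunction.moebius n : ℤ) : ℂ)) =
      (ArithmeticFunction.moebius : ArithmeticFunction ℂ) := by
  ext n
  rcases eq_or_ne n 0 with rfl | hn
  · simp [toArithmeticFunction]
  · rw [toAF_apply hn, intCoe_apply]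

omit [NeZero D] in
/-- The constant sequence `1` is the arithmetic function `ζ`. [folklore] -/
private theorem toAF_one :
    toArithmeticFunction (fun _ : ℕ => (1 : ℂ)) = (ArithmeticFunction.zeta : ArithmeticFunction ℂ) := by
  ext n
  rcases eq_or_ne n 0 with rfl | hn
  · simp [toArithmeticFunction]
  · rw [toAF_apply hn, natCoe_apply, zeta_apply, if_neg hn, Nat.cast_one]

omit [NeZero D] in
/-- Twisting by `χ` (completely multiplicative on `ℕ`) is multiplicative on arithmetic functions:
`χf ∗ χg = χ(f∗g)`. [folklore] -/
private theorem toAF_chi_mul (f g : ℕ → ℂ) :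
    toArithmeticFunction (fun n : ℕ => χ (n : ZMod D) * f n) *
        toArithmeticFunction (fun n : ℕ => χ (n : ZMod D) * g n) =
      toArithmeticFunction (fun n : ℕ => χ (n : ZMod D) * (f ⍟ g) n) := by
  have h : (fun n : ℕ => χ (n : ZMod D) * f n) ⍟ (fun n : ℕ => χ (n : ZMod D) * g n) =
      fun n : ℕ => χ (n : ZMod D) * (f ⍟ g) n := by
    rw [LSeries.convolution_def, LSeries.convolution_def]
    ext n
    rw [Finset.mul_sum]
    refine Finset.sum_congr rfl fun p hp => ?_
    have hpn : p.1 * p.2 = n := (Nat.mem_divisorsAntidiagonal.mp hp).1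
    rw [← hpn, Nat.cast_mul, map_mul]
    ring
  rw [← toArithmeticFunction_eq_self (toArithmeticFunction _ * toArithmeticFunction _)]
  exact congrArg toArithmeticFunction h

omit [NeZero D] in
/-- **`χ ∗ χμ = δ`**: the twist of `1 ∗ μ = δ`. [cite: Zhang2022LandauSiegel, §17 u008 p.96] -/
theorem toAF_chi_mul_toAF_chi_moebius :
    toArithmeticFunction (fun n : ℕ => χ (n : ZMod D)) *
        toArithmeticFunction (fun n : ℕ => ((ArithmeticFunction.moebius n : ℤ) : ℂ) * χ (n : ZMod D)) = 1 := by
  have e1 : (fun n : ℕ => χ (n : ZMod D)) = fun n : ℕ => χ (n : ZMod D) * (fun _ => (1 : ℂ)) n := by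
    funext n; simp
  have e2 : (fun n : ℕ => ((ArithmeticFunction.moebius n : ℤ) : ℂ) * χ (n : ZMod D)) =
      fun n : ℕ => χ (n : ZMod D) * (fun n : ℕ => ((ArithmeticFunction.moebius n : ℤ) : ℂ)) n := by
    funext n; ring
  rw [e1, e2, toAF_chi_mul]
  have h1 : ((fun _ : ℕ => (1 : ℂ)) ⍟ fun n : ℕ => ((ArithmeticFunction.moebius n : ℤ) : ℂ)) =
      ⇑(1 : ArithmeticFunction ℂ) := by
    show ⇑(toArithmeticFunction (fun _ : ℕ => (1 : ℂ)) *
      toArithmeticFunction (fun n : ℕ => ((ArithmeticFunction.moebius n : ℤ) : ℂ))) = _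
    rw [toAF_one, toAF_moebius, coe_zeta_mul_coe_moebius]
  rw [h1]
  ext n
  rcases eq_or_ne n 0 with rfl | hn
  · simp [toArithmeticFunction]
  · rw [toAF_apply hn]
    simp only [one_apply]
    split_ifs with h
    · subst h; simp
    · simp

/-! ## `ν*` as a ring product below `D⁴` -/

/-- **§17.u006 in the ring of arithmetic functions**: for `1 ≤ n < D⁴`,
`ν*(n) = (E₁μ · χA₁ · χA₂ · μ·χμ · E₂ · E₃)(n)` with `E₁ = powI b₁` (`κ₂ = E₁μ`), `E_j = nN β_j`,
`A₁ = ϰ₁+ι₂ϰ₂`, `A₂ = ῑ₃ϰ₃+ῑ₄ϰ₄` (`Typed.Section17.step17_u006N_holds`, `υ = μ ∗ χμ`).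
[cite: Zhang2022LandauSiegel, §17 u006 p.96] -/
theorem nuStar_eq_ringProduct {n : ℕ} (hn1 : 1 ≤ n) (hn4 : n < D ^ 4) :
    nuStar c' χ n =
      ((powI (b1 c' D) * (ArithmeticFunction.moebius : ArithmeticFunction ℂ)) *
        toArithmeticFunction (fun n : ℕ => χ (n : ZMod D) * (vk1 D n + iota2 * vk2 D n)) *
        toArithmeticFunction (fun n : ℕ => χ (n : ZMod D) * (conj iota3 * vk3 D n + conj iota4 * vk4 D n)) *
        ((ArithmeticFunction.moebius : ArithmeticFunction ℂ) *
          toArithmeticFunction (fun n : ℕ => ((ArithmeticFunction.moebius n : ℤ) : ℂ) * χ (n : ZMod D))) *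
        toArithmeticFunction (nN D (beta2 c' D)) * toArithmeticFunction (nN D (beta3 c' D))) n := by
  rw [step17_u006N_holds c' χ n hn1 hn4]
  -- every `⍟` is the multiplication of the associated arithmetic functions
  have hups : ups χ = ⇑((ArithmeticFunction.moebius : ArithmeticFunction ℂ) *
      toArithmeticFunction (fun n : ℕ => ((ArithmeticFunction.moebius n : ℤ) : ℂ) * χ (n : ZMod D))) := by
    rw [ups, ← toAF_moebius]
    rfl
  have hK : (fun n : ℕ => kappa₂ (b1 c' D) n) = ⇑(powI (b1 c' D) * (ArithmeticFunction.moebius : ArithmeticFunction ℂ)) := by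
    funext n; rfl
  rw [hups, hK]
  simp only [LSeries.convolution, toArithmeticFunction_eq_self]

/-- Rearranging the product of §17.u006 into the engine's normal form (pure commutative algebra).
[folklore] -/
private theorem product_rearrange {A : Type*} [CommRing A] [Algebra ℂ A]
    (Z M E₁ E₂ E₃ XZ XM XA₁ XA₂ : A) (c₁ c₂ : ℂ) :
    E₁ * M * XA₁ * XA₂ * (M * XM) * E₂ * E₃ =
      (Z + (E₁ - Z)) * (Z + (E₂ - Z)) * (Z + (E₃ - Z)) * M * M *
        ((c₁ • XZ + (XA₁ - c₁ • XZ)) * (c₂ • XZ + (XA₂ - c₂ • XZ)) * XM) := by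
  simp only [add_sub_cancel]
  ring

/-! ## The bound, given the pointwise sizes -/

/-- **`|ν*(n) − 𝔢₀ᴰν(n)| ≤ B_η(n)` for `1 ≤ n < D⁴`, given the pointwise sizes.** If `η ≥ 0` and on
`1 ≤ m < D⁴`: `|m^{−β₁} − 1| ≤ η` (`powI b₁`), `|nN β₂(m) − 1|, |nN β₃(m) − 1| ≤ η`,
`|χ(m)(A₁(m) − A₁(1))| ≤ (1+|ι₂|)η`, `|χ(m)(A₂(m) − A₂(1))| ≤ (|ι₃|+|ι₄|)η`, then
`|ν*(n) − 𝔢₀ᴰ ν(n)| ≤ |𝔢₀ᴰ|(3ητ₂+3η²τ₄+η³τ₆)(n) + (|A₁(1)|(|ι₃|+|ι₄|)+|A₂(1)|(1+|ι₂|))η(τ₂+3ητ₂+3η²τ₄+η³τ₆)(n)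
 + (1+|ι₂|)(|ι₃|+|ι₄|)η²(τ₄+3ητ₄+3η²τ₆+η³τ₈)(n)` (`Section17U007Engine.norm_error_le` with `Z = ζ`,
`M = μ`, `XZ = χ`, `XM = χμ`). [cite: Zhang2022LandauSiegel, §17 u007 p.96] -/
theorem norm_nuStar_sub_frake0D_nu_le_of_bounds {η : ℝ} (hη : 0 ≤ η)
    (hE₁ : ∀ m : ℕ, m ≠ 0 → m < D ^ 4 → ‖powI (b1 c' D) m - 1‖ ≤ η)
    (hE₂ : ∀ m : ℕ, m ≠ 0 → m < D ^ 4 → ‖nN D (beta2 c' D) m - 1‖ ≤ η)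
    (hE₃ : ∀ m : ℕ, m ≠ 0 → m < D ^ 4 → ‖nN D (beta3 c' D) m - 1‖ ≤ η)
    (hA₁ : ∀ m : ℕ, m ≠ 0 → m < D ^ 4 →
      ‖χ (m : ZMod D) * (vk1 D m + iota2 * vk2 D m) - (vk1 D 1 + iota2 * vk2 D 1) * χ (m : ZMod D)‖ ≤
        (1 + ‖iota2‖) * η)
    (hA₂ : ∀ m : ℕ, m ≠ 0 → m < D ^ 4 →
      ‖χ (m : ZMod D) * (conj iota3 * vk3 D m + conj iota4 * vk4 D m) -
          (conj iota3 * vk3 D 1 + conj iota4 * vk4 D 1) * χ (m : ZMod D)‖ ≤ (‖iota3‖ + ‖iota4‖) * η) :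
    ∀ n : ℕ, n ≠ 0 → n < D ^ 4 →
      ‖nuStar c' χ n - frake0D D * nu χ n‖ ≤
        ‖frake0D D‖ * (3 * η * tau 2 n + 3 * η ^ 2 * tau 4 n + η ^ 3 * tau 6 n) +
        (‖vk1 D 1 + iota2 * vk2 D 1‖ * (‖iota3‖ + ‖iota4‖) +
            ‖conj iota3 * vk3 D 1 + conj iota4 * vk4 D 1‖ * (1 + ‖iota2‖)) * η *
          (tau 2 n + 3 * η * tau 2 n + 3 * η ^ 2 * tau 4 n + η ^ 3 * tau 6 n) +
        (1 + ‖iota2‖) * (‖iota3‖ + ‖iota4‖) * η ^ 2 *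
          (tau 4 n + 3 * η * tau 4 n + 3 * η ^ 2 * tau 6 n + η ^ 3 * tau 8 n) := by
  intro n hn0 hn
  have hZM : (ArithmeticFunction.zeta : ArithmeticFunction ℂ) * (ArithmeticFunction.moebius : ArithmeticFunction ℂ) = 1 :=
    coe_zeta_mul_coe_moebius
  have hX := toAF_chi_mul_toAF_chi_moebius χ
  -- `ν*(n)` and the main term in the ring, in the engine's normal form
  have hprod := nuStar_eq_ringProduct c' χ (Nat.one_le_iff_ne_zero.mpr hn0) hn
  rw [product_rearrange (ArithmeticFunction.zeta : ArithmeticFunction ℂ) _ _ _ _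
    (toArithmeticFunction (fun n : ℕ => χ (n : ZMod D))) _ _ _
    (vk1 D 1 + iota2 * vk2 D 1) (conj iota3 * vk3 D 1 + conj iota4 * vk4 D 1)] at hprod
  have hmain : frake0D D * nu χ n =
      (((vk1 D 1 + iota2 * vk2 D 1) * (conj iota3 * vk3 D 1 + conj iota4 * vk4 D 1)) •
        ((ArithmeticFunction.zeta : ArithmeticFunction ℂ) *
          toArithmeticFunction (fun n : ℕ => χ (n : ZMod D)))) n := by
    rw [show ∀ (c : ℂ) (F : ArithmeticFunction ℂ), (c • F) n = c * F n from fun c F => by simp,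
      Phi3Eval.nuAF_apply χ n, frake0D]
  rw [hprod, hmain, ← af_sub_apply]
  -- the hypotheses of the engine
  have hχ1 : ∀ m : ℕ, ‖χ (m : ZMod D)‖ ≤ 1 := fun m => DirichletCharacter.norm_le_one χ _
  have hμ1 : ∀ m : ℕ, ‖((ArithmeticFunction.moebius m : ℤ) : ℂ)‖ ≤ 1 := fun m => by
    rw [Complex.norm_intCast]
    exact_mod_cast ArithmeticFunction.abs_moebius_le_one
  have hζ : ∀ m : ℕ, m ≠ 0 → (ArithmeticFunction.zeta : ArithmeticFunction ℂ) m = 1 := fun m hm => by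
    rw [natCoe_apply, zeta_apply, if_neg hm, Nat.cast_one]
  have bZ : ∀ m : ℕ, m ≠ 0 → m < D ^ 4 → ‖(ArithmeticFunction.zeta : ArithmeticFunction ℂ) m‖ ≤ 1 :=
    fun m hm _ => by rw [hζ m hm]; simp
  have bM : ∀ m : ℕ, m ≠ 0 → m < D ^ 4 → ‖(ArithmeticFunction.moebius : ArithmeticFunction ℂ) m‖ ≤ 1 :=
    fun m _ _ => by rw [intCoe_apply]; exact hμ1 m
  have bXZ : ∀ m : ℕ, m ≠ 0 → m < D ^ 4 → ‖toArithmeticFunction (fun n : ℕ => χ (n : ZMod D)) m‖ ≤ 1 :=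
    fun m hm _ => by rw [toAF_apply hm]; exact hχ1 m
  have bXM : ∀ m : ℕ, m ≠ 0 → m < D ^ 4 →
      ‖toArithmeticFunction (fun n : ℕ => ((ArithmeticFunction.moebius n : ℤ) : ℂ) * χ (n : ZMod D)) m‖ ≤ 1 :=
    fun m hm _ => by
    rw [toAF_apply hm, norm_mul]
    calc ‖((ArithmeticFunction.moebius m : ℤ) : ℂ)‖ * ‖χ (m : ZMod D)‖ ≤ 1 * 1 :=
          mul_le_mul (hμ1 m) (hχ1 m) (norm_nonneg _) zero_le_one
      _ = 1 := one_mul _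
  have bΔ₁ : ∀ m : ℕ, m ≠ 0 → m < D ^ 4 →
      ‖(powI (b1 c' D) - (ArithmeticFunction.zeta : ArithmeticFunction ℂ)) m‖ ≤ η := fun m hm hm4 => by
    rw [af_sub_apply, hζ m hm]
    exact hE₁ m hm hm4
  have bΔ₂ : ∀ m : ℕ, m ≠ 0 → m < D ^ 4 →
      ‖(toArithmeticFunction (nN D (beta2 c' D)) - (ArithmeticFunction.zeta : ArithmeticFunction ℂ)) m‖ ≤ η :=
    fun m hm hm4 => by
    rw [af_sub_apply, hζ m hm, toAF_apply hm]
    exact hE₂ m hm hm4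
  have bΔ₃ : ∀ m : ℕ, m ≠ 0 → m < D ^ 4 →
      ‖(toArithmeticFunction (nN D (beta3 c' D)) - (ArithmeticFunction.zeta : ArithmeticFunction ℂ)) m‖ ≤ η :=
    fun m hm hm4 => by
    rw [af_sub_apply, hζ m hm, toAF_apply hm]
    exact hE₃ m hm hm4
  have hsm : ∀ (c : ℂ) (F : ArithmeticFunction ℂ) (m : ℕ), (c • F) m = c * F m := fun c F m => by simp
  have bR₁ : ∀ m : ℕ, m ≠ 0 → m < D ^ 4 →
      ‖(toArithmeticFunction (fun n : ℕ => χ (n : ZMod D) * (vk1 D n + iota2 * vk2 D n)) -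
          (vk1 D 1 + iota2 * vk2 D 1) • toArithmeticFunction (fun n : ℕ => χ (n : ZMod D))) m‖ ≤
        (1 + ‖iota2‖) * η := fun m hm hm4 => by
    rw [af_sub_apply, hsm, toAF_apply hm, toAF_apply hm]
    exact hA₁ m hm hm4
  have bR₂ : ∀ m : ℕ, m ≠ 0 → m < D ^ 4 →
      ‖(toArithmeticFunction (fun n : ℕ => χ (n : ZMod D) * (conj iota3 * vk3 D n + conj iota4 * vk4 D n)) -
          (conj iota3 * vk3 D 1 + conj iota4 * vk4 D 1) •
            toArithmeticFunction (fun n : ℕ => χ (n : ZMod D))) m‖ ≤ (‖iota3‖ + ‖iota4‖) * η :=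
    fun m hm hm4 => by
    rw [af_sub_apply, hsm, toAF_apply hm, toAF_apply hm]
    exact hA₂ m hm hm4
  have key := norm_error_le (N := D ^ 4) _ _ _ _ _ _ _ _ _ (vk1 D 1 + iota2 * vk2 D 1)
    (conj iota3 * vk3 D 1 + conj iota4 * vk4 D 1) hη (by positivity) (by positivity) hZM hX bZ bM bXZ bXM
    bΔ₁ bΔ₂ bΔ₃ bR₁ bR₂ n hn0 hn
  have hcc : ‖(vk1 D 1 + iota2 * vk2 D 1) * (conj iota3 * vk3 D 1 + conj iota4 * vk4 D 1)‖ = ‖frake0D D‖ := by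
    rw [frake0D]
  rw [hcc] at key
  refine key.trans (le_of_eq ?_)
  ring

end Literature.NumberTheory.LFunctions.Zhang2022.U007

end
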